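import Literature.NumberTheory.GaloisRepresentations.QuarticTwistEulerFactors
import Literature.NumberTheory.EllipticCurves.QuarticTwistLSeriesCoefficients
import Literature.NumberTheory.EllipticCurves.ComplexMultiplicationLocalFactorsAux
import Literature.NumberTheory.NumberFields.CyclotomicFieldFourNormConjugation
import Literature.NumberTheory.Automorphic.GaloisActionPlaces
import Mathlib.NumberTheory.NumberField.Cyclotomic.Ideal
import HarnessLib

/-!
# The ideal Größencharakter datum of `y² = x³ − Dx` over `ℚ(i)`: `ψ₀(𝔭) = e((D/ϖ_𝔭)₄³ · ϖ_𝔭) mod (8D)`, with Deuring's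
# split / inert Frobenius values against `a_p(E_D)` (Ireland–Rosen Ch. 18 §6, Theorem 7)

Topic `NumberTheory/GaloisRepresentations`; namespace `Literature.NumberTheory.GaloisRepresentations` (sub-namespace
`QuarticTwistDatum`). Theorems only (no definition, no named fact). Sequel of `QuarticTwistHeckeCharacter` (whose
`exists_heckeCharacter_quarticTwist` hides the Größencharakter behind an `∃`) and `QuarticTwistEulerFactors` (the local
identities): here the datum is EXPORTED by name so that its algebraic Hecke character `heckeOfGross` can be fed to the
tree's «Deuring shape» (`heckeLFunction_eq_LSeries_of_frobenius`: split `ψ₀(𝔭) + ψ₀(c𝔭) = a_p`, `ψ₀(𝔭)ψ₀(c𝔭) = p`; inert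
`a_p = 0`, `ψ₀(𝔭) = −p`), for `E_D = [0, 0, 0, −D, 0]` and every prime `p ∤ 2D`.

* §0 (private) `IsGrossencharakter.of_le'` — change of modulus (the tree's public copy lives in a heavy Bianchi module).
* §1 `isGrossencharakter_gen` — `𝔭 ↦ e((D/ϖ_𝔭)₄³)·e(ϖ_𝔭)` IS a Größencharakter `mod (8D)` of type `(embType e, embTypeConj e)`;
  `heckeOfGross_gen_spec` — its Hecke character at `𝔭 ∤ 8D`: unramified, `ψ(ϖ_𝔭) = e((D/ϖ_𝔭)₄³ ϖ_𝔭)`.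
* §2 places of `ℚ(i)` over an odd prime `p`: `p ≡ 1 (4)` ⇒ `N𝔭 = p` and `c • 𝔭 ≠ 𝔭`; `p ≡ 3 (4)` ⇒ `𝔭 = (p)` and `c • 𝔭 = 𝔭`;
  the primary generator of `c • 𝔭` is `σ̂(ϖ_𝔭)`.
* §3 ★ `frobenius_gen` — Deuring's values against `a_p(E_D) = (⟨0,0,0,−D,0⟩ : WeierstrassCurve ℚ).LFunction p`, `p ∤ 2D`.

## References
* K. Ireland, M. Rosen, *A Classical Introduction to Modern Number Theory*, 2nd ed. (1990), Ch. 18 §4 Thm. 5, §6 Thm. 7. [IrelandRosen1990]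
* J. H. Silverman, *Advanced Topics in the Arithmetic of Elliptic Curves* (1994), II Thm. 10.5, Ex. 2.30–2.34. [SilvermanATAEC1994]
* J. Neukirch, *Algebraic Number Theory* (1999), Ch. VII §6 Cor. (6.14). [NeukirchANT1999]

## Mathlib / tree search
Tree: `isGrossencharakter_quarticTwist`, `idealPow_quarticResidueSymbol_pow_three` (`QuarticTwistHeckeCharacter`); `isGrossencharakter_primaryGen`,
`primaryGen`, `span_primaryGen`, `primaryGen_sub_one_mem`, `IsGrossencharakter.mul`; `heckeOfGross_valueAtUniformizer/_isUnramifiedAt`;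
`pow_three_mul_add_mul_galRestrict_eq`, `pow_three_mul_mul_pow_three_mul_eq_natCast`, `quarticResidueSymbol_pow_three_mul_neg_natCast`
(`QuarticTwistEulerFactors`); `eq_span_natCast_of_mem_of_mod_four_eq_three`, `exists_prime_eq_mul_galRestrict_of_mod_four_eq_one`,
`galRestrict_apply_eq_neg_four`, `eq_of_span_eq_of_sub_one_mem_span_four`; `QuarticTwist.lFunction_apply_prime_of_mod_four_eq_three`,
`natCard_point_eq_one_add_card`, `Automorphic.lFunction_map_apply_prime_of_not_dvd`. Mathlib: `IsCyclotomicExtension.Rat.inertiaDeg_eq_of_not_dvd`,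
`Ideal.absNorm_eq_pow_inertiaDeg'`, `Ideal.pointwise_smul_def`.
-/

noncomputable section

namespace Literature.NumberTheory.GaloisRepresentations

open Finset NumberField IsDedekindDomain Literature.NumberTheory.NumberFields
open scoped Pointwise

/-! ### §0 Change of modulus -/

section General

variable {K : Type*} [Field K] [NumberField K]

/-- A Größencharakter `mod 𝔣` is a Größencharakter `mod 𝔣'` for every `𝔣' ≤ 𝔣` (characters of `J^𝔣/P^𝔣` pull back along
`J^{𝔣'}/P^{𝔣'} → J^𝔣/P^𝔣`). [cite: NeukirchANT1999, Ch. VII §6 Def. (6.1)] -/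
private theorem IsGrossencharakter.of_le' {𝔣 𝔣' : Ideal (𝓞 K)} {p q : InfinitePlace K → ℤ}
    {ψ : HeightOneSpectrum (𝓞 K) → ℂ} (h : IsGrossencharakter 𝔣 p q ψ) (hle : 𝔣' ≤ 𝔣) :
    IsGrossencharakter 𝔣' p q ψ := by
  refine ⟨fun v hv => h.ne_zero v fun h' => hv (le_trans hle h'), fun b c hb hc hcop hbc hpos => ?_⟩
  refine h.idealPow_span_eq b c hb hc ?_ (hle hbc) hpos
  obtain ⟨i, hi, j, hj, hij⟩ := Ideal.isCoprime_iff_exists.mp hcop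
  exact Ideal.isCoprime_iff_exists.mpr ⟨i, hi, j, hle hj, hij⟩

end General

namespace QuarticTwistDatum

variable {K : Type} [Field K] [NumberField K] [IsCyclotomicExtension {4} ℚ K] [IsPrincipalIdealRing (𝓞 K)]
variable {ζ : 𝓞 K} (hζ : IsPrimitiveRoot ζ 4)

/-! ### §1 The datum `ψ₀(𝔭) = e((D/ϖ_𝔭)₄³) · e(ϖ_𝔭)` modulo `(8D)` -/

omit [NumberField K] [IsCyclotomicExtension {4} ℚ K] [IsPrincipalIdealRing (𝓞 K)] in
include hζ in
/-- `(8D) ⊆ (2 + 2i)` (`8D = (2 − 2i)(2 + 2i)·D`). [cite: IrelandRosen1990, Ch. 18 §6, Theorem 7 (proof)] -/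
theorem span_le_span_two_add (D : ℤ) : Ideal.span {((8 * D : ℤ) : 𝓞 K)} ≤ Ideal.span {(2 + 2 * ζ : 𝓞 K)} := by
  have hζ2 : ζ ^ 2 = -1 := (hζ.pow (by norm_num) (show 4 = 2 * 2 by norm_num)).eq_neg_one_of_two_right
  exact Ideal.span_singleton_le_span_singleton.mpr ⟨(2 - 2 * ζ) * D, by push_cast; linear_combination ((4 : 𝓞 K) * D) * hζ2⟩

omit [IsCyclotomicExtension {4} ℚ K] [IsPrincipalIdealRing (𝓞 K)] in
/-- `(8D) ≠ 0` for `D ≠ 0`. [cite: IrelandRosen1990, Ch. 18 §6, Theorem 7] -/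
theorem span_ne_bot {D : ℤ} (hD : D ≠ 0) : Ideal.span {((8 * D : ℤ) : 𝓞 K)} ≠ ⊥ := by
  rw [Ne, Ideal.span_singleton_eq_bot]; exact_mod_cast (show 8 * D ≠ 0 by omega)

omit [IsPrincipalIdealRing (𝓞 K)] in
include hζ in
/-- `(2 + 2i) ≠ 0`. [cite: IrelandRosen1990, Ch. 9 §7] -/
theorem span_two_add_ne_bot : Ideal.span {(2 + 2 * ζ : 𝓞 K)} ≠ ⊥ := by
  rw [Ne, Ideal.span_singleton_eq_bot, show (2 + 2 * ζ : 𝓞 K) = 2 * (1 + ζ) by ring]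
  exact mul_ne_zero two_ne_zero (prime_one_add_four hζ).ne_zero

omit [IsCyclotomicExtension {4} ℚ K] [IsPrincipalIdealRing (𝓞 K)] in
/-- A maximal ideal `𝔭 ⊉ J` is coprime to `J`. [cite: NeukirchANT1999, Ch. I §3 (3.1)] -/
theorem isCoprime_asIdeal_of_not_le {J : Ideal (𝓞 K)} {𝔭 : HeightOneSpectrum (𝓞 K)} (h : ¬ J ≤ 𝔭.asIdeal) :
    IsCoprime 𝔭.asIdeal J :=
  Ideal.isCoprime_iff_sup_eq.mpr (𝔭.isMaximal.out.2 _ (left_lt_sup.mpr h))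

omit [IsCyclotomicExtension {4} ℚ K] [IsPrincipalIdealRing (𝓞 K)] in
/-- In a prime `𝔭 ∋ p`, an integer `n` prime to `p` does not lie in `𝔭`. [cite: NeukirchANT1999, Ch. I §3 (3.1)] -/
theorem intCast_notMem {p : ℕ} (hp : p.Prime) {n : ℤ} (hn : ¬ (p : ℤ) ∣ n) {𝔭 : HeightOneSpectrum (𝓞 K)}
    (hp𝔭 : (p : 𝓞 K) ∈ 𝔭.asIdeal) : ((n : ℤ) : 𝓞 K) ∉ 𝔭.asIdeal := by
  intro hmem
  have hcop : IsCoprime (p : ℤ) n := (Prime.coprime_iff_not_dvd (Nat.prime_iff_prime_int.mp hp)).mpr hn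
  obtain ⟨a, b, hab⟩ := hcop
  have h1 : (1 : 𝓞 K) = (a : 𝓞 K) * ((p : ℕ) : 𝓞 K) + (b : 𝓞 K) * ((n : ℤ) : 𝓞 K) := by exact_mod_cast hab.symm
  exact 𝔭.isPrime.ne_top (by
    rw [Ideal.eq_top_iff_one, h1]
    exact 𝔭.asIdeal.add_mem (𝔭.asIdeal.mul_mem_left _ hp𝔭) (𝔭.asIdeal.mul_mem_left _ hmem))

include hζ in
/-- ★ **The Größencharakter of `y² = x³ − Dx`, exported**: `𝔭 ↦ e((D/ϖ_𝔭)₄³) · e(ϖ_𝔭)`, `ϖ_𝔭 ≡ 1 (2 + 2i)` the primary generator,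
is a Größencharakter `mod (8D)` of type `(embType e, embTypeConj e)` (weight one) — the product of the finite-order twist
`isGrossencharakter_quarticTwist` and `isGrossencharakter_primaryGen` (modulus `(2 + 2i) ⊇ (8D)`). [cite: IrelandRosen1990, Ch. 18 §6, Theorem 7] -/
theorem isGrossencharakter_gen (e : K →+* ℂ) {D : ℤ} (hD : D ≠ 0) :
    IsGrossencharakter (Ideal.span {((8 * D : ℤ) : 𝓞 K)}) (embType e) (embTypeConj e)
      (fun v => (e (quarticResidueSymbol v (Ideal.Quotient.mk v.asIdeal (D : 𝓞 K)) ^ 3) : ℂ) *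
        e (primaryGen (exists_units_mul_sub_one_mem_span_four hζ) v)) := by
  have h := (isGrossencharakter_quarticTwist hζ e hD).mul
    ((isGrossencharakter_primaryGen (exists_units_mul_sub_one_mem_span_four hζ) (units_eq_one_of_sub_one_mem_span_four hζ)
      (span_two_add_ne_bot hζ) e).of_le' (span_le_span_two_add hζ D))
  simpa only [Pi.zero_apply, zero_add] using h

include hζ in
/-- **The Hecke character of the datum at a prime `𝔭 ∤ 8D`**: `𝔭 = (ϖ_𝔭)` with `ϖ_𝔭 ≡ 1 (2 + 2i)`, `ψ` is unramified at `𝔭` and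
`ψ(ϖ_𝔭) = e((D/ϖ_𝔭)₄³ · ϖ_𝔭)` (Neukirch VII (6.14): `χ̃(𝔭) = χ(𝔭)`) — the hypothesis `hψ` of `QuarticTwistEulerFactors`.
[cite: IrelandRosen1990, Ch. 18 §6, Theorem 7] [cite: NeukirchANT1999, Ch. VII §6 Cor. (6.14)] -/
theorem heckeOfGross_gen_spec (e : K →+* ℂ) {D : ℤ} (hD : D ≠ 0) (v : HeightOneSpectrum (𝓞 K))
    (hv : ¬ Ideal.span {((8 * D : ℤ) : 𝓞 K)} ≤ v.asIdeal) :
    (v.asIdeal = Ideal.span {primaryGen (exists_units_mul_sub_one_mem_span_four hζ) v} ∧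
        primaryGen (exists_units_mul_sub_one_mem_span_four hζ) v - 1 ∈ Ideal.span {(2 + 2 * ζ : 𝓞 K)}) ∧
      (heckeOfGross (span_ne_bot hD) (isGrossencharakter_gen hζ e hD)).IsUnramifiedAt v ∧
      (heckeOfGross (span_ne_bot hD) (isGrossencharakter_gen hζ e hD)).valueAtUniformizer v =
        e (quarticResidueSymbol v (Ideal.Quotient.mk v.asIdeal (D : 𝓞 K)) ^ 3 *
          primaryGen (exists_units_mul_sub_one_mem_span_four hζ) v) := by
  have hle2 : ¬ Ideal.span {(2 + 2 * ζ : 𝓞 K)} ≤ v.asIdeal := fun h => hv (le_trans (span_le_span_two_add hζ D) h)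
  refine ⟨⟨(span_primaryGen _ hle2).symm, primaryGen_sub_one_mem _ hle2⟩, heckeOfGross_isUnramifiedAt _ _ hv, ?_⟩
  rw [heckeOfGross_valueAtUniformizer _ _ hv]
  rw [map_mul]

/-! ### §2 The places of `ℚ(i)` over an odd prime -/

omit [IsPrincipalIdealRing (𝓞 K)] in
/-- **`N𝔭 = p` for a place `𝔭 ∋ p`, `p ≡ 1 (4)`** (Mathlib's cyclotomic splitting law: `f = ord₄ p = 1`).
[cite: IrelandRosen1990, Ch. 9 §7 Lemma 5] -/
theorem residueCard_eq_of_mod_four_eq_one {p : ℕ} (hp : p.Prime) (hp1 : p % 4 = 1) {𝔭 : HeightOneSpectrum (𝓞 K)}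
    (hp𝔭 : (p : 𝓞 K) ∈ 𝔭.asIdeal) : 𝔭.residueCard = p := by
  haveI := Fact.mk hp
  have hp2 : p ≠ 2 := by rintro rfl; norm_num at hp1
  haveI : 𝔭.asIdeal.LiesOver (Ideal.span {(p : ℤ)}) := by
    refine ⟨?_⟩
    have hmax : (Ideal.span {(p : ℤ)}).IsMaximal :=
      PrincipalIdealRing.isMaximal_of_irreducible (Nat.prime_iff_prime_int.mp hp).irreducible
    refine hmax.eq_of_le (Ideal.comap_ne_top _ 𝔭.isPrime.ne_top) ?_
    rw [Ideal.span_singleton_le_iff_mem, Ideal.mem_comap, map_natCast]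
    exact hp𝔭
  haveI : 𝔭.asIdeal.IsMaximal := 𝔭.isMaximal
  have h4 : ¬ p ∣ 4 := fun h =>
    hp2 ((Nat.prime_dvd_prime_iff_eq hp Nat.prime_two).mp (hp.dvd_of_dvd_pow (show p ∣ 2 ^ 2 by simpa using h)))
  have hord : orderOf (p : ZMod 4) = 1 := by
    have hp4 : (p : ZMod 4) = 1 := by rw [← ZMod.natCast_mod p 4, hp1]; rfl
    rw [hp4, orderOf_one]
  rw [HeightOneSpectrum.residueCard, Ideal.absNorm_eq_pow_inertiaDeg' 𝔭.asIdeal hp,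
    Ideal.inertiaDeg'_eq_inertiaDeg (Ideal.span {(p : ℤ)}) 𝔭.asIdeal,
    IsCyclotomicExtension.Rat.inertiaDeg_eq_of_not_dvd p K 𝔭.asIdeal (m := 4) h4, hord, pow_one]

omit [IsCyclotomicExtension {4} ℚ K] [IsPrincipalIdealRing (𝓞 K)] in
/-- `c • x = σ̂ x` on `𝓞 K` (the tree's action of `Aut(K/ℚ)` on `𝓞 K` is Mathlib's `galRestrict`). [cite: NeukirchANT1999, Ch. I §9 (before (9.1))] -/
theorem smul_eq_galRestrict (c : K ≃ₐ[ℚ] K) (x : 𝓞 K) : c • x = galRestrict ℤ ℚ K (𝓞 K) c x := by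
  apply FaithfulSMul.algebraMap_injective (𝓞 K) K
  rw [algebraMap_galRestrict_apply]
  rfl

omit [IsCyclotomicExtension {4} ℚ K] [IsPrincipalIdealRing (𝓞 K)] in
/-- `(c • 𝔭) = σ̂(𝔭)` as ideals: `(c • 𝔭).asIdeal = 𝔭.asIdeal.map σ̂`. [cite: NeukirchANT1999, Ch. I §9 (before (9.1))] -/
theorem smul_asIdeal_eq_map (c : K ≃ₐ[ℚ] K) (𝔭 : HeightOneSpectrum (𝓞 K)) :
    (c • 𝔭).asIdeal = 𝔭.asIdeal.map (galRestrict ℤ ℚ K (𝓞 K) c : 𝓞 K ≃+* 𝓞 K) := by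
  have hf : MulSemiringAction.toRingHom (K ≃ₐ[ℚ] K) (𝓞 K) c =
      ((galRestrict ℤ ℚ K (𝓞 K) c : 𝓞 K ≃+* 𝓞 K) : 𝓞 K →+* 𝓞 K) :=
    RingHom.ext fun x => by rw [MulSemiringAction.toRingHom_apply, smul_eq_galRestrict]; rfl
  rw [Literature.NumberTheory.Automorphic.HeightOneSpectrum.smul_asIdeal, Ideal.pointwise_smul_def, hf, Ideal.map_coe]

omit [IsCyclotomicExtension {4} ℚ K] [IsPrincipalIdealRing (𝓞 K)] in
/-- `(c • (x)) = (σ̂ x)`. [cite: NeukirchANT1999, Ch. I §9 (before (9.1))] -/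
theorem smul_asIdeal_of_eq_span (c : K ≃ₐ[ℚ] K) {𝔭 : HeightOneSpectrum (𝓞 K)} {x : 𝓞 K} (h : 𝔭.asIdeal = Ideal.span {x}) :
    (c • 𝔭).asIdeal = Ideal.span {galRestrict ℤ ℚ K (𝓞 K) c x} := by
  rw [smul_asIdeal_eq_map, h, Ideal.map_span, Set.image_singleton]; rfl

omit [IsCyclotomicExtension {4} ℚ K] [IsPrincipalIdealRing (𝓞 K)] in
/-- `p ∈ c • 𝔭` when `p ∈ 𝔭`. [cite: NeukirchANT1999, Ch. I §9 (before (9.1))] -/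
theorem natCast_mem_smul (c : K ≃ₐ[ℚ] K) {𝔭 : HeightOneSpectrum (𝓞 K)} {p : ℕ} (hp𝔭 : (p : 𝓞 K) ∈ 𝔭.asIdeal) :
    (p : 𝓞 K) ∈ (c • 𝔭).asIdeal := by
  rw [smul_asIdeal_eq_map, ← map_natCast (galRestrict ℤ ℚ K (𝓞 K) c : 𝓞 K ≃+* 𝓞 K) p]
  exact Ideal.mem_map_of_mem _ hp𝔭

omit [IsCyclotomicExtension {4} ℚ K] [IsPrincipalIdealRing (𝓞 K)] in
/-- `c • (c • 𝔭) = 𝔭` (`c² = 1` in `Gal(ℚ(i)/ℚ)`). [cite: IrelandRosen1990, Ch. 9 §7 Lemma 5] -/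
theorem smul_smul_eq [IsCyclotomicExtension {4} ℚ K] (c : K ≃ₐ[ℚ] K) (𝔭 : HeightOneSpectrum (𝓞 K)) : c • (c • 𝔭) = 𝔭 := by
  rw [smul_smul, algEquiv_mul_self_four c, one_smul]

omit [IsPrincipalIdealRing (𝓞 K)] in
/-- **`p ≡ 3 (4)`: the place over `p` is `(p)` and is fixed by `c`.** [cite: IrelandRosen1990, Ch. 9 §7 Lemma 4] -/
theorem smul_eq_self_of_mod_four_eq_three {p : ℕ} (hp : p.Prime) (hp3 : p % 4 = 3) (c : K ≃ₐ[ℚ] K)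
    {𝔭 : HeightOneSpectrum (𝓞 K)} (hp𝔭 : (p : 𝓞 K) ∈ 𝔭.asIdeal) : c • 𝔭 = 𝔭 := by
  have h𝔭 : 𝔭.asIdeal = Ideal.span {(p : 𝓞 K)} := eq_span_natCast_of_mem_of_mod_four_eq_three hp hp3 𝔭.isPrime hp𝔭
  apply HeightOneSpectrum.ext
  rw [smul_asIdeal_of_eq_span c h𝔭, map_natCast, ← h𝔭]

omit [IsPrincipalIdealRing (𝓞 K)] in
/-- **`p ≡ 1 (4)`: a place over `p` is moved by `c ≠ 1`** (`(p) = (π)(σ̂π)` with `(π) ≠ (σ̂π)`, Lemma 5).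
[cite: IrelandRosen1990, Ch. 9 §7 Lemma 5] -/
theorem smul_ne_self_of_mod_four_eq_one {p : ℕ} (hp : p.Prime) (hp1 : p % 4 = 1) {c : K ≃ₐ[ℚ] K} (hc : c ≠ 1)
    {𝔭 : HeightOneSpectrum (𝓞 K)} (hp𝔭 : (p : 𝓞 K) ∈ 𝔭.asIdeal) : c • 𝔭 ≠ 𝔭 := by
  obtain ⟨π, hπ, hpπ, hne⟩ := exists_prime_eq_mul_galRestrict_of_mod_four_eq_one (K := K) hc hp hp1
  set τ := galRestrict ℤ ℚ K (𝓞 K) c with hτ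
  have hττ : ∀ x : 𝓞 K, τ (τ x) = x := fun x => by
    apply FaithfulSMul.algebraMap_injective (𝓞 K) K
    rw [hτ, algebraMap_galRestrict_apply, algebraMap_galRestrict_apply]
    exact algEquiv_algEquiv_apply_four c _
  have hmax : ∀ {x : 𝓞 K}, Prime x → (Ideal.span {x}).IsMaximal := fun hx =>
    ((Ideal.span_singleton_prime hx.ne_zero).mpr hx).isMaximal (by rw [Ne, Ideal.span_singleton_eq_bot]; exact hx.ne_zero)
  have hτπ : Prime (τ π) := (MulEquiv.prime_iff (τ : 𝓞 K ≃+* 𝓞 K)).mpr hπ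
  rw [hpπ] at hp𝔭
  rcases 𝔭.isPrime.mem_or_mem hp𝔭 with h | h
  · have h𝔭 : 𝔭.asIdeal = Ideal.span {π} :=
      ((hmax hπ).eq_of_le 𝔭.isPrime.ne_top ((Ideal.span_singleton_le_iff_mem _).mpr h)).symm
    intro heq
    apply hne
    rw [← h𝔭, ← smul_asIdeal_of_eq_span c h𝔭, heq]
  · have h𝔭 : 𝔭.asIdeal = Ideal.span {τ π} :=
      ((hmax hτπ).eq_of_le 𝔭.isPrime.ne_top ((Ideal.span_singleton_le_iff_mem _).mpr h)).symm
    intro heq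
    apply hne
    have h2 := smul_asIdeal_of_eq_span c h𝔭
    rw [heq, hττ] at h2
    rw [← h2, h𝔭]

include hζ in
/-- **The primary generator of the conjugate place is the conjugate**: `ϖ_{c • 𝔭} = σ̂(ϖ_𝔭)` for `𝔭 ∤ 8D` (`σ̂` preserves
`(2 + 2i)` and primary generators are unique). [cite: IrelandRosen1990, Ch. 18 §6, Theorem 7 (proof)] -/
theorem primaryGen_smul {c : K ≃ₐ[ℚ] K} (hc : c ≠ 1) {D : ℤ} {𝔭 : HeightOneSpectrum (𝓞 K)}
    (hv : ¬ Ideal.span {((8 * D : ℤ) : 𝓞 K)} ≤ 𝔭.asIdeal) (hcv : ¬ Ideal.span {((8 * D : ℤ) : 𝓞 K)} ≤ (c • 𝔭).asIdeal) :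
    primaryGen (exists_units_mul_sub_one_mem_span_four hζ) (c • 𝔭) =
      galRestrict ℤ ℚ K (𝓞 K) c (primaryGen (exists_units_mul_sub_one_mem_span_four hζ) 𝔭) := by
  set τ := galRestrict ℤ ℚ K (𝓞 K) c with hτ
  set ϖ := primaryGen (exists_units_mul_sub_one_mem_span_four hζ) 𝔭
  have hle2 : ¬ Ideal.span {(2 + 2 * ζ : 𝓞 K)} ≤ 𝔭.asIdeal := fun h => hv (le_trans (span_le_span_two_add hζ D) h)
  have hle2' : ¬ Ideal.span {(2 + 2 * ζ : 𝓞 K)} ≤ (c • 𝔭).asIdeal := fun h => hcv (le_trans (span_le_span_two_add hζ D) h)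
  have h𝔭 : 𝔭.asIdeal = Ideal.span {ϖ} := (span_primaryGen _ hle2).symm
  have hprim : ϖ - 1 ∈ Ideal.span {(2 + 2 * ζ : 𝓞 K)} := primaryGen_sub_one_mem _ hle2
  have hspan' : (c • 𝔭).asIdeal = Ideal.span {τ ϖ} := smul_asIdeal_of_eq_span c h𝔭
  -- `σ̂ ϖ ≡ 1 (2 + 2i)`: `σ̂(2 + 2ζ) = 2 - 2ζ = -ζ · (2 + 2ζ)`
  have hζ2 : ζ ^ 2 = -1 := (hζ.pow (by norm_num) (show 4 = 2 * 2 by norm_num)).eq_neg_one_of_two_right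
  have hτprim : τ ϖ - 1 ∈ Ideal.span {(2 + 2 * ζ : 𝓞 K)} := by
    obtain ⟨a, ha⟩ := Ideal.mem_span_singleton'.mp hprim
    have hτζ : τ ζ = -ζ := by rw [hτ]; exact galRestrict_apply_eq_neg_four hc hζ
    have h1 : τ ϖ - 1 = τ a * (2 + 2 * τ ζ) := by
      have h := congrArg τ ha
      rw [map_mul, map_add, map_mul, map_sub, map_one, map_ofNat] at h
      exact h.symm
    rw [h1, hτζ, Ideal.mem_span_singleton']
    exact ⟨τ a * (-ζ), by linear_combination (-(2 : 𝓞 K) * τ a) * hζ2⟩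
  have hcop : IsCoprime (Ideal.span {primaryGen (exists_units_mul_sub_one_mem_span_four hζ) (c • 𝔭)})
      (Ideal.span {(2 + 2 * ζ : 𝓞 K)}) := by
    rw [span_primaryGen _ hle2']; exact isCoprime_asIdeal_of_not_le hle2'
  exact eq_of_span_eq_of_sub_one_mem_span_four hζ (by rw [span_primaryGen _ hle2', hspan']) hcop
    (primaryGen_sub_one_mem _ hle2') hτprim

/-! ### §3 Deuring's split / inert values against `a_p(E_D)` -/

omit [IsCyclotomicExtension {4} ℚ K] [IsPrincipalIdealRing (𝓞 K)] in
/-- A prime `𝔭 ∋ p`, `p ∤ 2D` odd, is prime to `(8D)`. [cite: IrelandRosen1990, Ch. 18 §6, Theorem 7 (proof)] -/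
theorem not_span_le_of_not_dvd {p : ℕ} (hp : p.Prime) {D : ℤ} (hp2 : p ≠ 2) (hD : ¬ (p : ℤ) ∣ D)
    {𝔭 : HeightOneSpectrum (𝓞 K)} (hp𝔭 : (p : 𝓞 K) ∈ 𝔭.asIdeal) :
    ¬ Ideal.span {((8 * D : ℤ) : 𝓞 K)} ≤ 𝔭.asIdeal := by
  rw [Ideal.span_singleton_le_iff_mem]
  have hp8D : ¬ (p : ℤ) ∣ 8 * D := by
    intro hd
    rcases (Nat.prime_iff_prime_int.mp hp).dvd_or_dvd hd with h8 | h8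
    · have h8' : p ∣ 2 ^ 3 := by exact_mod_cast h8
      exact hp2 ((Nat.prime_dvd_prime_iff_eq hp Nat.prime_two).mp (hp.dvd_of_dvd_pow h8'))
    · exact hD h8
  exact intCast_notMem hp hp8D hp𝔭

omit [IsCyclotomicExtension {4} ℚ K] [IsPrincipalIdealRing (𝓞 K)] in
/-- **`a_p(E_D) = p − #{(x,y) ∈ (ℤ/p)² : y² = x³ − Dx}`** for `p ∤ 2D` (`a_p = p + 1 − #E_D(𝔽_p)`, the point at infinity).
[cite: IrelandRosen1990, Ch. 18 §4 Theorem 5; §6 Theorem 7 (proof)] [cite: SilvermanAEC2009, App. C §16] -/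
theorem lFunction_eq_sub_card {p : ℕ} [hp : Fact p.Prime] {D : ℤ} (hp2D : ¬ (p : ℤ) ∣ 2 * D) :
    ((⟨0, 0, 0, -(D : ℚ), 0⟩ : WeierstrassCurve ℚ).LFunction p : ℤ) =
      (p : ℤ) - (#{q : ZMod p × ZMod p | q.2 ^ 2 = q.1 ^ 3 - (D : ZMod p) * q.1} : ℕ) := by
  classical
  have hmapQ : (⟨0, 0, 0, -D, 0⟩ : WeierstrassCurve ℤ).map (Int.castRingHom ℚ) = ⟨0, 0, 0, -(D : ℚ), 0⟩ := by
    simp [WeierstrassCurve.map]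
  rw [← hmapQ, Automorphic.lFunction_map_apply_prime_of_not_dvd _ hp.out
      (Literature.NumberTheory.EllipticCurves.QuarticTwist.not_dvd_Δ_int hp.out hp2D),
    Automorphic.frobeniusTrace, Automorphic.numPointsMod]
  have hmap : (⟨0, 0, 0, -D, 0⟩ : WeierstrassCurve ℤ).map (Int.castRingHom (ZMod p)) = ⟨0, 0, 0, -(D : ZMod p), 0⟩ := by
    simp [WeierstrassCurve.map]
  have hD0 : (D : ZMod p) ≠ 0 := by
    rw [Ne, ZMod.intCast_zmod_eq_zero_iff_dvd]; exact fun h => hp2D (dvd_mul_of_dvd_right h 2)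
  have hp2 : (2 : ZMod p) ≠ 0 := by
    intro h2
    have h2' : ((2 : ℤ) : ZMod p) = 0 := by exact_mod_cast h2
    rw [ZMod.intCast_zmod_eq_zero_iff_dvd] at h2'
    exact hp2D (dvd_mul_of_dvd_left h2' D)
  have hΔ : (⟨0, 0, 0, -(D : ZMod p), 0⟩ : WeierstrassCurve (ZMod p)).Δ ≠ 0 := by
    haveI : (⟨0, 0, 0, -(D : ZMod p), 0⟩ : WeierstrassCurve (ZMod p)).IsShortNF := ⟨rfl, rfl, rfl⟩
    rw [WeierstrassCurve.Δ_of_isShortNF]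
    dsimp only
    have h64 : (64 : ZMod p) ≠ 0 := by
      rw [show (64 : ZMod p) = 2 ^ 6 by norm_num]; exact pow_ne_zero 6 hp2
    intro h0
    apply mul_ne_zero h64 (pow_ne_zero 3 hD0)
    linear_combination h0
  rw [hmap, WeierstrassCurve.natCard_point_eq_one_add_card _ hΔ, Fintype.card_subtype]
  have hset : #{xy : ZMod p × ZMod p | xy.2 ^ 2 + (0 : ZMod p) * xy.1 * xy.2 + 0 * xy.2 =
      xy.1 ^ 3 + 0 * xy.1 ^ 2 + -(D : ZMod p) * xy.1 + 0} = #{q : ZMod p × ZMod p | q.2 ^ 2 = q.1 ^ 3 - (D : ZMod p) * q.1} := by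
    congr 1; ext q; simp only [mem_filter, mem_univ, true_and]; constructor <;> intro h <;> linear_combination h
  rw [hset]; push_cast; ring

include hζ in
/-- ★ **Deuring's Frobenius values of the `E_D`-datum against `a_p(E_D)`** (Ireland–Rosen Thm. 18.7, proof, both cases, read in the
Deuring shape of Silverman II Thm. 10.5): for a prime `p ∤ 2D`, `c ≠ 1` and a place `𝔭 ∋ p` of `ℚ(i)`, with
`ψ₀(𝔭) = e((D/ϖ_𝔭)₄³)·e(ϖ_𝔭)`: `𝔭 ∤ (8D)`; if `c • 𝔭 ≠ 𝔭` (`p ≡ 1 (4)`): `ψ₀(𝔭) + ψ₀(c • 𝔭) = a_p(E_D)` and `ψ₀(𝔭) ψ₀(c • 𝔭) = p`;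
if `c • 𝔭 = 𝔭` (`p ≡ 3 (4)`): `a_p(E_D) = 0` and `ψ₀(𝔭) = −p`. [cite: IrelandRosen1990, Ch. 18 §6, Theorem 7 (proof)] [cite: SilvermanATAEC1994, Ch. II Thm. 10.5 (b)] -/
theorem frobenius_gen (e : K →+* ℂ) {c : K ≃ₐ[ℚ] K} (hc : c ≠ 1) {D : ℤ} {p : ℕ} [hp : Fact p.Prime]
    (hp2D : ¬ (p : ℤ) ∣ 2 * D) {𝔭 : HeightOneSpectrum (𝓞 K)} (hp𝔭 : (p : 𝓞 K) ∈ 𝔭.asIdeal) :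
    ¬ Ideal.span {((8 * D : ℤ) : 𝓞 K)} ≤ 𝔭.asIdeal ∧
    (c • 𝔭 ≠ 𝔭 →
      (e (quarticResidueSymbol 𝔭 (Ideal.Quotient.mk 𝔭.asIdeal (D : 𝓞 K)) ^ 3) : ℂ) *
            e (primaryGen (exists_units_mul_sub_one_mem_span_four hζ) 𝔭) +
          (e (quarticResidueSymbol (c • 𝔭) (Ideal.Quotient.mk (c • 𝔭).asIdeal (D : 𝓞 K)) ^ 3) : ℂ) *
            e (primaryGen (exists_units_mul_sub_one_mem_span_four hζ) (c • 𝔭)) =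
          (((⟨0, 0, 0, -(D : ℚ), 0⟩ : WeierstrassCurve ℚ).LFunction p : ℤ) : ℂ) ∧
        (e (quarticResidueSymbol 𝔭 (Ideal.Quotient.mk 𝔭.asIdeal (D : 𝓞 K)) ^ 3) : ℂ) *
            e (primaryGen (exists_units_mul_sub_one_mem_span_four hζ) 𝔭) *
          ((e (quarticResidueSymbol (c • 𝔭) (Ideal.Quotient.mk (c • 𝔭).asIdeal (D : 𝓞 K)) ^ 3) : ℂ) *
            e (primaryGen (exists_units_mul_sub_one_mem_span_four hζ) (c • 𝔭))) = p) ∧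
    (c • 𝔭 = 𝔭 → (⟨0, 0, 0, -(D : ℚ), 0⟩ : WeierstrassCurve ℚ).LFunction p = 0 ∧
      (e (quarticResidueSymbol 𝔭 (Ideal.Quotient.mk 𝔭.asIdeal (D : 𝓞 K)) ^ 3) : ℂ) *
          e (primaryGen (exists_units_mul_sub_one_mem_span_four hζ) 𝔭) = -(p : ℂ)) := by
  have hp' := hp.out
  have hp2 : p ≠ 2 := by rintro rfl; exact hp2D (dvd_mul_right 2 D)
  have hpD : ¬ (p : ℤ) ∣ D := fun h => hp2D (dvd_mul_of_dvd_right h 2)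
  have hv : ¬ Ideal.span {((8 * D : ℤ) : 𝓞 K)} ≤ 𝔭.asIdeal := not_span_le_of_not_dvd hp' hp2 hpD hp𝔭
  have hcp𝔭 : (p : 𝓞 K) ∈ (c • 𝔭).asIdeal := natCast_mem_smul c hp𝔭
  have hcv : ¬ Ideal.span {((8 * D : ℤ) : 𝓞 K)} ≤ (c • 𝔭).asIdeal := not_span_le_of_not_dvd hp' hp2 hpD hcp𝔭
  have hle2 : ¬ Ideal.span {(2 + 2 * ζ : 𝓞 K)} ≤ 𝔭.asIdeal := fun h => hv (le_trans (span_le_span_two_add hζ D) h)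
  set ϖ := primaryGen (exists_units_mul_sub_one_mem_span_four hζ) 𝔭 with hϖdef
  have h𝔭 : 𝔭.asIdeal = Ideal.span {ϖ} := (span_primaryGen _ hle2).symm
  have hprim : ϖ - 1 ∈ Ideal.span {(2 + 2 * ζ : 𝓞 K)} := primaryGen_sub_one_mem _ hle2
  have hodd : p % 4 = 1 ∨ p % 4 = 3 := by
    rcases hp'.eq_two_or_odd with h | h
    · exact absurd h hp2
    · omega
  refine ⟨hv, fun hne => ?_, fun heq => ?_⟩
  · -- split: `p ≡ 1 (4)`
    have hp1 : p % 4 = 1 := by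
      rcases hodd with h | h
      · exact h
      · exact absurd (smul_eq_self_of_mod_four_eq_three hp' h c hp𝔭) hne
    have hN : 𝔭.residueCard = p := residueCard_eq_of_mod_four_eq_one hp' hp1 hp𝔭
    have hgen : primaryGen (exists_units_mul_sub_one_mem_span_four hζ) (c • 𝔭) = galRestrict ℤ ℚ K (𝓞 K) c ϖ :=
      primaryGen_smul hζ hc hv hcv
    have h𝔭' : (c • 𝔭).asIdeal = 𝔭.asIdeal.map (galRestrict ℤ ℚ K (𝓞 K) c : 𝓞 K ≃+* 𝓞 K) := smul_asIdeal_eq_map c 𝔭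
    -- `(D/𝔭)₄ = (D/c𝔭)₄³` (conjugating twice returns to `𝔭`)
    have h𝔭'' : 𝔭.asIdeal = (c • 𝔭).asIdeal.map (galRestrict ℤ ℚ K (𝓞 K) c : 𝓞 K ≃+* 𝓞 K) := by
      rw [← smul_asIdeal_eq_map, smul_smul_eq]
    have hconj : quarticResidueSymbol 𝔭 (Ideal.Quotient.mk 𝔭.asIdeal (D : 𝓞 K)) =
        quarticResidueSymbol (c • 𝔭) (Ideal.Quotient.mk (c • 𝔭).asIdeal (D : 𝓞 K)) ^ 3 :=
      quarticResidueSymbol_conj_place hζ hc h𝔭'' D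
    have hsum := pow_three_mul_add_mul_galRestrict_eq hζ hc hpD h𝔭 hprim hN
    have hprod := pow_three_mul_mul_pow_three_mul_eq_natCast hζ hc hpD h𝔭 hprim h𝔭' hN
    -- the identities in `𝓞 K`
    have key₁ : quarticResidueSymbol 𝔭 (Ideal.Quotient.mk 𝔭.asIdeal (D : 𝓞 K)) ^ 3 * ϖ +
        quarticResidueSymbol (c • 𝔭) (Ideal.Quotient.mk (c • 𝔭).asIdeal (D : 𝓞 K)) ^ 3 *
          primaryGen (exists_units_mul_sub_one_mem_span_four hζ) (c • 𝔭) =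
        (p : 𝓞 K) - (#{q : ZMod p × ZMod p | q.2 ^ 2 = q.1 ^ 3 - (D : ZMod p) * q.1} : ℕ) := by
      rw [hgen, ← hconj]; exact hsum
    have key₂ : quarticResidueSymbol 𝔭 (Ideal.Quotient.mk 𝔭.asIdeal (D : 𝓞 K)) ^ 3 * ϖ *
        (quarticResidueSymbol (c • 𝔭) (Ideal.Quotient.mk (c • 𝔭).asIdeal (D : 𝓞 K)) ^ 3 *
          primaryGen (exists_units_mul_sub_one_mem_span_four hζ) (c • 𝔭)) = (p : 𝓞 K) := by
      rw [hgen]; exact hprod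
    have key₁' := congrArg (fun x : 𝓞 K => e (x : K)) key₁
    have key₂' := congrArg (fun x : 𝓞 K => e (x : K)) key₂
    push_cast at key₁' key₂' ⊢
    simp only [map_add, map_sub, map_mul, map_pow, map_natCast] at key₁' key₂' ⊢
    refine ⟨?_, key₂'⟩
    rw [key₁', lFunction_eq_sub_card hp2D]
    push_cast
    ring
  · -- inert: `p ≡ 3 (4)`
    have hp3 : p % 4 = 3 := by
      rcases hodd with h | h
      · exact absurd heq (smul_ne_self_of_mod_four_eq_one hp' h hc hp𝔭)
      · exact h
    have hspan : 𝔭.asIdeal = Ideal.span {-(p : 𝓞 K)} := by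
      rw [Ideal.span_singleton_neg]; exact eq_span_natCast_of_mem_of_mod_four_eq_three hp' hp3 𝔭.isPrime hp𝔭
    have hcop : IsCoprime (Ideal.span {ϖ}) (Ideal.span {(2 + 2 * ζ : 𝓞 K)}) := by
      rw [← h𝔭]; exact isCoprime_asIdeal_of_not_le hle2
    have hϖ : ϖ = -(p : 𝓞 K) :=
      eq_of_span_eq_of_sub_one_mem_span_four hζ (h𝔭 ▸ hspan) hcop hprim (neg_natCast_sub_one_mem_span hζ hp3)
    refine ⟨Literature.NumberTheory.EllipticCurves.QuarticTwist.lFunction_apply_prime_of_mod_four_eq_three hp' hp3 hpD, ?_⟩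
    have key := congrArg (fun x : 𝓞 K => e (x : K)) (quarticResidueSymbol_pow_three_mul_neg_natCast hζ hp3 hpD hp𝔭)
    rw [hϖ]
    push_cast at key ⊢
    simp only [map_mul, map_pow, map_neg, map_natCast] at key ⊢
    exact key

end QuarticTwistDatum

end Literature.NumberTheory.GaloisRepresentations
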